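import Mathlib
import Literature.NumberTheory.EllipticCurves.Smith2016.CongruentNumberGenusDeterminantForest
import Literature.NumberTheory.EllipticCurves.Smith2016.CongruentNumberRedeiDeterminant
import Literature.NumberTheory.EllipticCurves.Smith2016.CongruentNumberGenusDeterminantTwoPrimes
import Literature.NumberTheory.EllipticCurves.CongruentNumberMonskySelmerParitySymbols
import Literature.NumberTheory.EllipticCurves.HeathBrown1994.CongruentTwoSelmerFengXiongFamilies

/-!
# Smith 2016, Theorem 2.2 row 1: the block weight of the forest sum IS `[d ≡ 1 (8)] · g(d)`

Continuation of `CongruentNumberGenusDeterminantForest` (A. Smith, arXiv:1603.08479, §2,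
[Smith2016CongruentDensity]).  There `det M₁ = Σ_π ∏_{B∈π} (1 + Σ_{i∈B} zᵢ)·q_z(A^B)` was proved
for every number `k` of primes; here the block weight is identified with the Smith/Tian–Yuan–Zhang
weight of the block: for `p : Fin k → ℕ` distinct odd primes, `A` Monsky's matrix, `zᵢ = (2/pᵢ)₊` and
`∅ ≠ B ⊆ Fin k` with `d_B = ∏_{i∈B} pᵢ`,
`(1 + Σ_{i∈B} zᵢ) · q_z(A^B) = [d_B ≡ 1 (mod 8)] · g(d_B)` in `𝔽₂` (`blockWeight_eq_genusWeight`),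
`g(d) = #2Cl(ℚ(√−d))` (`genusClassNumber (GenusField d)`).  Steps: the column form
`q_z(B) = det (A^B with a column replaced by z)` (all cofactors along a column of a zero-row-sum matrix
agree, [Smith2016CongruentDensity, §2 Prop. 2.4: the matrix `Q(A, z)`]); the re-indexing of the
block `B` to Monsky's matrix of the sub-tuple `p|_B`; then Smith's Table 2 row `d ≡ 1 (8)` in the tree
(`odd_genusClassNumber_genusField_iff_det_updateCol`, Rédei–Reichardt), the vanishing of
`det Q` for `d_B ≡ 7 (8)` (column sums `(1 + Σu)u` of `A`, Monsky's (31)), and `(2/d_B) = −1` for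
`d_B ≡ 3, 5 (8)`.  What remains for `smith_thm22_rowOne` (all `k`) after this file is only the
bijection `decompositions (∏ pᵢ) ≃ set partitions of Fin k` (see the cell note).
-/

namespace Literature.NumberTheory.EllipticCurves.Smith2016

open _root_.Matrix Finset Literature.LinearAlgebra.Matrix Literature.Combinatorics.Enumerative
open Literature.NumberTheory.EllipticCurves.HeathBrown1994
open Literature.NumberTheory.EllipticCurves.TianYuanZhang2017
open Literature.NumberTheory.EllipticCurves.HeathBrown1994.Families (legendreMatrix_apply_of_ne legendreMatrix_apply_self)
open Literature.NumberTheory.EllipticCurves (MonskySelmerParity.odd_prod MonskySelmerParity.one_vecMul_legendreMatrix MonskySelmerParity.sum_addLegendreSym_neg_one_eq)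

section ColumnForm

variable {V : Type*} [Fintype V] [LinearOrder V]

/-- The Laplacian-type matrix of a block kills the indicator vector of the block (zero row sums).
[cite: Smith2016CongruentDensity, §2 Prop. 2.4 ("an `r × r` matrix … whose rows sum to zero")] -/
theorem lap_mulVec_indicator (a : V → V → ZMod 2) (B : Finset V) :
    lap a B 0 *ᵥ (fun j => if j ∈ B then (1 : ZMod 2) else 0) = 0 := by
  ext i
  rw [Pi.zero_apply, mulVec, dotProduct]
  simp only [mul_ite, mul_one, mul_zero]
  rw [← sum_filter, filter_mem_eq_inter, univ_inter]
  by_cases hi : i ∈ B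
  · have hrow : ∀ j ∈ B.erase i, lap a B 0 i j = a i j := fun j hj => by
      rw [lap_apply, if_pos (And.intro hi (mem_of_mem_erase hj)), if_neg (ne_of_mem_erase hj).symm]
    rw [← add_sum_erase B _ hi, sum_congr rfl hrow, lap_apply, if_pos (And.intro hi hi), if_pos rfl,
      Pi.zero_apply, zero_add]
    exact CharTwo.add_self_eq_zero _
  · refine sum_eq_zero fun j hj => ?_
    have hij : i ≠ j := fun h => hi (by rw [h]; exact hj)
    rw [lap_apply, if_neg (fun h => hi h.1), if_neg hij]

/-- **All cofactors along a column agree**: for `t, c ∈ B`,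
`det (L with row t ← e_c) = det (L with row t ← e_t)` (`L` the Laplacian-type matrix of `B`).
[cite: Smith2016CongruentDensity, §2.1 (chunk p0006 L58–L66: `det A[[r]−{1},[r]−{j}]` for any `j`)] -/
theorem det_updateRow_lap_single (a : V → V → ZMod 2) {B : Finset V} {t c : V} (ht : t ∈ B)
    (hc : c ∈ B) :
    ((lap a B 0).updateRow t (Pi.single c 1)).det = ((lap a B 0).updateRow t (Pi.single t 1)).det := by
  have hdec : (Pi.single c (1 : ZMod 2) : V → ZMod 2) =
      Pi.single t 1 + (Pi.single c 1 - Pi.single t 1) := by abel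
  rw [hdec, det_updateRow_add]
  suffices h0 : ((lap a B 0).updateRow t (Pi.single c 1 - Pi.single t 1)).det = 0 by
    rw [h0, add_zero]
  refine Matrix.exists_mulVec_eq_zero_iff.mp ⟨fun j => if j ∈ B then (1 : ZMod 2) else 0, ?_, ?_⟩
  · intro h
    have := congrFun h t
    simp [ht] at this
  · ext i
    rw [Pi.zero_apply]
    change (((lap a B 0).updateRow t (Pi.single c 1 - Pi.single t 1)) i) ⬝ᵥ _ = 0
    by_cases hit : i = t
    · subst hit
      rw [updateRow_self, sub_dotProduct, single_dotProduct, single_dotProduct, if_pos hc, if_pos ht,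
        sub_self]
    · rw [updateRow_ne hit]
      have h := congrFun (lap_mulVec_indicator a B) i
      rw [Pi.zero_apply] at h
      exact h

omit [Fintype V] in
/-- Deleting `t ∈ B`: `unitize (L_B) t` is the Laplacian-type matrix of `B ∖ t` with the extra diagonal
`a • t`. [cite: ChebotarevAgaev2002, §3 Thm. 1 (matrix-tree theorem: delete row and column t)] -/
theorem unitize_lap (a : V → V → ZMod 2) {B : Finset V} {t : V} (ht : t ∈ B) :
    unitize (lap a B 0) t = lap a (B.erase t) (fun i => a i t) := by
  ext i j
  rw [unitize_apply, lap_apply, lap_apply]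
  simp only [mem_erase, ne_eq, Pi.zero_apply, zero_add]
  by_cases hj : j = t
  · subst hj; simp
  · by_cases hi : i = t
    · subst hi; simp [hj, Ne.symm hj]
    · simp only [hj, hi, if_false, not_false_eq_true, true_and]
      by_cases hiB : i ∈ B
      · by_cases hjB : j ∈ B
        · rw [if_pos (And.intro hiB hjB), if_pos (And.intro hiB hjB)]
          by_cases hij : i = j
          · rw [if_pos hij, if_pos hij, ← add_sum_erase (B.erase i) _ (mem_erase.mpr ⟨Ne.symm hi, ht⟩),
              erase_right_comm]
          · rw [if_neg hij, if_neg hij]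
        · have hij : i ≠ j := fun h => hjB (by rw [← h]; exact hiB)
          rw [if_neg (show ¬(i ∈ B ∧ j ∈ B) from fun h => hjB h.2), if_neg hij,
            if_neg (show ¬(i ∈ B ∧ j ∈ B) from fun h => hjB h.2)]
      · by_cases hij : i = j
        · subst hij
          rw [if_neg (show ¬(i ∈ B ∧ i ∈ B) from fun h => hiB h.1), if_pos rfl,
            if_neg (show ¬(i ∈ B ∧ i ∈ B) from fun h => hiB h.1)]
        · rw [if_neg (show ¬(i ∈ B ∧ j ∈ B) from fun h => hiB h.1), if_neg hij,
            if_neg (show ¬(i ∈ B ∧ j ∈ B) from fun h => hiB h.1)]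

/-- **Column form of the block weight**: `q_x(B) = det (L_B with column c replaced by x·1_B)`
(`c ∈ B`), i.e. Smith's `det Q(A, z)[B]`. [cite: Smith2016CongruentDensity, §2 Prop. 2.4 (the matrix `Q(A, z) = (A[[r],[r−1]] z)`)] -/
theorem qwt_eq_det_updateCol (a : V → V → ZMod 2) (x : V → ZMod 2) {B : Finset V} {c : V}
    (hc : c ∈ B) :
    qwt a x B = ((lap a B 0).updateCol c (fun i => if i ∈ B then x i else 0)).det := by
  have hw : (fun i => if i ∈ B then x i else 0) =
      ∑ t ∈ B, x t • (Pi.single t (1 : ZMod 2) : V → ZMod 2) := by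
    ext i
    rw [Finset.sum_apply]
    simp only [Pi.smul_apply, Pi.single_apply, smul_eq_mul, mul_ite, mul_one, mul_zero]
    rw [Finset.sum_ite_eq]
  rw [hw, det_updateCol_finset_sum, qwt]
  refine sum_congr rfl fun t ht => ?_
  rw [det_updateCol_smul, det_updateCol_single_eq_det_updateRow_single,
    det_updateRow_lap_single a ht hc, ← det_unitize, unitize_lap a ht, treeDet]

end ColumnForm

section Blocks

variable {k : ℕ} (p : Fin k → ℕ)

/-- The sub-tuple of `p` indexed by a block `B ⊆ Fin k` (enumerated by `B.equivFin`).
A notation-free abbreviation used only inside this file's statements.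
[cite: Smith2016CongruentDensity, §2.1 Remark 2.3 ("the M_x that corresponds to d is M_x(A, z)[S]")] -/
theorem prod_subtuple (B : Finset (Fin k)) :
    ∏ x : Fin B.card, p ((B.equivFin.symm x : {i // i ∈ B}) : Fin k) = ∏ i ∈ B, p i := by
  rw [Equiv.prod_comp B.equivFin.symm (fun u : {i // i ∈ B} => p (u : Fin k))]
  exact Finset.prod_coe_sort B p

/-- Sums over the sub-tuple are sums over the block. [cite: Smith2016CongruentDensity, §2.1 Remark 2.3] -/
theorem sum_subtuple {M : Type*} [AddCommMonoid M] (B : Finset (Fin k)) (f : ℕ → M) :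
    ∑ x : Fin B.card, f (p ((B.equivFin.symm x : {i // i ∈ B}) : Fin k)) = ∑ i ∈ B, f (p i) := by
  rw [Equiv.sum_comp B.equivFin.symm (fun u : {i // i ∈ B} => f (p (u : Fin k)))]
  exact Finset.sum_coe_sort B (fun j => f (p j))

/-- **Re-indexing a block to Monsky's matrix of the sub-tuple**: for `c ∈ B` and a column `w`
supported on `B`, `det (L_B with column c ← w)` (ambient `Fin k × Fin k`, identity outside `B`) equals
`det (legendreMatrix p|_B with column c ← w|_B)`. [cite: Smith2016CongruentDensity, §2.1 Remark 2.3] -/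
theorem det_updateCol_lap_eq_subtuple (B : Finset (Fin k)) {c : Fin k} (hc : c ∈ B)
    (w : Fin k → ZMod 2) (hw : ∀ i, i ∉ B → w i = 0) :
    ((lap (fun i j => legendreMatrix p i j) B 0).updateCol c w).det =
      ((legendreMatrix (fun x : Fin B.card => p ((B.equivFin.symm x : {i // i ∈ B}) : Fin k))).updateCol
        (B.equivFin ⟨c, hc⟩) (fun x => w ((B.equivFin.symm x : {i // i ∈ B}) : Fin k))).det := by
  set M := (lap (fun i j => legendreMatrix p i j) B 0).updateCol c w with hM
  set e := B.equivFin with he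
  have hMij : ∀ i j, M i j = if j = c then w i else lap (fun i j => legendreMatrix p i j) B 0 i j := by
    intro i j; rw [hM, updateCol_apply]
  have h0 : ∀ i, ¬ (i ∈ B) → ∀ j, j ∈ B → M i j = 0 := by
    intro i hi j hj
    rw [hMij]
    by_cases hjc : j = c
    · rw [if_pos hjc, hw i hi]
    · have hij : i ≠ j := fun h => hi (by rw [h]; exact hj)
      rw [if_neg hjc, lap_apply, if_neg (fun h => hi h.1), if_neg hij]
  have h1 : M.toSquareBlockProp (fun i => ¬ i ∈ B) = 1 := by
    ext ⟨i, hi⟩ ⟨j, hj⟩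
    have hjc : j ≠ c := fun h => hj (by rw [h]; exact hc)
    rw [toSquareBlockProp_def, of_apply, hMij, if_neg hjc, lap_apply, if_neg (fun h => hi h.1), one_apply]
    by_cases hij : i = j
    · subst hij; simp
    · rw [if_neg hij, if_neg (fun h => hij (congrArg Subtype.val h))]
  have h5 : (M.toSquareBlockProp (fun a => a ∈ B)).submatrix e.symm e.symm =
      (legendreMatrix (fun x : Fin B.card => p ((B.equivFin.symm x : {i // i ∈ B}) : Fin k))).updateCol
        (B.equivFin ⟨c, hc⟩) (fun x => w ((B.equivFin.symm x : {i // i ∈ B}) : Fin k)) := by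
    ext x y
    rw [submatrix_apply, toSquareBlockProp_def, of_apply, hMij, updateCol_apply, ← he]
    have hyc : ((e.symm y : {i // i ∈ B}) : Fin k) = c ↔ y = e ⟨c, hc⟩ := by
      constructor
      · intro h
        have : e.symm y = ⟨c, hc⟩ := Subtype.ext h
        rw [← this, Equiv.apply_symm_apply]
      · intro h; rw [h, Equiv.symm_apply_apply]
    by_cases hy : y = e ⟨c, hc⟩
    · rw [if_pos (hyc.mpr hy), if_pos hy]
    · rw [if_neg (fun h => hy (hyc.mp h)), if_neg hy, lap_apply,
        if_pos (And.intro (e.symm x).2 (e.symm y).2)]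
      by_cases hxy : x = y
      · subst hxy
        have hx : ((e.symm x : {i // i ∈ B}) : Fin k) ∈ B := (e.symm x).2
        rw [if_pos rfl, Pi.zero_apply, zero_add, legendreMatrix_apply_self,
          sum_congr rfl fun j hj => legendreMatrix_apply_of_ne _ (ne_of_mem_erase hj).symm,
          sum_congr rfl fun j hj => legendreMatrix_apply_of_ne _ (ne_of_mem_erase hj).symm,
          sum_erase_eq_sub hx, sum_erase_eq_sub (mem_univ x)]
        congr 1
        rw [he]
        exact (sum_subtuple p B (fun n => addLegendreSym n
          (p ((B.equivFin.symm x : {i // i ∈ B}) : Fin k)))).symm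
      · have hne : ((e.symm x : {i // i ∈ B}) : Fin k) ≠ ((e.symm y : {i // i ∈ B}) : Fin k) :=
          fun h => hxy (e.symm.injective (Subtype.ext h))
        rw [if_neg hne, legendreMatrix_apply_of_ne p hne, legendreMatrix_apply_of_ne _ hxy]
  have h2 := Matrix.twoBlockTriangular_det M (fun a => a ∈ B) h0
  have h4 := det_submatrix_equiv_self e.symm (M.toSquareBlockProp (fun a => a ∈ B))
  rw [h5] at h4
  rw [h2, h1, det_one, mul_one]
  convert h4.symm using 2

/-- **Block weight = the Smith / Tian–Yuan–Zhang weight `[d_B ≡ 1 (8)] · g(d_B)`** for every block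
`∅ ≠ B ⊆ Fin k` of a tuple of distinct odd primes:
`(1 + Σ_{i∈B} (2/pᵢ)₊) · q_z(A^B) = [∏_B pᵢ ≡ 1 (mod 8)] · g(∏_B pᵢ)` in `𝔽₂`
(`d_B ≡ 3, 5 (8)`: the prefactor vanishes; `d_B ≡ 7 (8)`: the column sums of `Q` vanish by Monsky's
(31); `d_B ≡ 1 (8)`: Smith's Table 2 via Rédei–Reichardt).
[cite: Smith2016CongruentDensity, §2 Thm. 2.2 row 1 with Prop. 2.4 and Table 2 (chunk p0005 L26–L44, p0006 L23–L34)] -/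
theorem blockWeight_eq_genusWeight (hp : ∀ i, (p i).Prime) (hodd : ∀ i, Odd (p i))
    (hinj : Function.Injective p) {B : Finset (Fin k)} (hB : B.Nonempty) :
    (1 + ∑ i ∈ B, addLegendreSym 2 (p i)) *
        qwt (fun i j => legendreMatrix p i j) (fun i => addLegendreSym 2 (p i)) B =
      if (∏ i ∈ B, p i) % 8 = 1 then
        ((genusClassNumber (GenusField (∏ i ∈ B, p i)) : ℕ) : ZMod 2) else 0 := by
  obtain ⟨c, hc⟩ := hB
  set q : Fin B.card → ℕ := fun x => p ((B.equivFin.symm x : {i // i ∈ B}) : Fin k) with hq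
  have hqp : ∀ x, (q x).Prime := fun x => hp _
  have hqo : ∀ x, Odd (q x) := fun x => hodd _
  have hq2 : ∀ x, q x ≠ 2 := fun x h => by
    have h3 := hqo x
    rw [h] at h3
    exact absurd h3 (by decide)
  have hqinj : Function.Injective q := fun x y h =>
    B.equivFin.symm.injective (Subtype.ext (hinj h))
  have hprod : ∏ x, q x = ∏ i ∈ B, p i := prod_subtuple p B
  have h11 : (1 : ZMod 2) + 1 = 0 := by decide
  have hdodd : Odd (∏ i ∈ B, p i) := hprod ▸ MonskySelmerParity.odd_prod q hqp hq2
  have hd2 : (∏ i ∈ B, p i) % 2 = 1 := Nat.odd_iff.mp hdodd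
  -- the prefactor
  have hz : ∑ i ∈ B, addLegendreSym 2 (p i) =
      if (∏ i ∈ B, p i) % 8 = 3 ∨ (∏ i ∈ B, p i) % 8 = 5 then (1 : ZMod 2) else 0 :=
    HeathBrown1994.Families.sum_addLegendreSym_two_eq B p fun i _ => Nat.odd_iff.mp (hodd i)
  -- the column form of the block weight, re-indexed to the sub-tuple
  have hqwt : qwt (fun i j => legendreMatrix p i j) (fun i => addLegendreSym 2 (p i)) B =
      ((legendreMatrix q).updateCol (B.equivFin ⟨c, hc⟩) fun x => addLegendreSym 2 (q x)).det := by
    rw [qwt_eq_det_updateCol _ _ hc, det_updateCol_lap_eq_subtuple p B hc _ (fun i hi => if_neg hi)]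
    congr 2
    funext x
    rw [if_pos (B.equivFin.symm x).2]
  by_cases h1 : (∏ i ∈ B, p i) % 8 = 1
  · -- `d ≡ 1 (8)`: Rédei–Reichardt (Smith's Table 2)
    rw [if_pos h1, hz, if_neg (by omega), add_zero, one_mul, hqwt]
    symm
    refine natCast_eq_of_odd_iff ?_
    have h4 : (∏ x, q x) % 4 = 1 := by rw [hprod]; omega
    have h := odd_genusClassNumber_genusField_iff_det_updateCol q hqp hqo hqinj h4 (B.equivFin ⟨c, hc⟩)
    rw [hprod] at h
    exact h
  · rw [if_neg h1]
    by_cases h7 : (∏ i ∈ B, p i) % 8 = 7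
    · -- `d ≡ 7 (8)`: the column sums of `Q` vanish
      rw [hz, if_neg (by omega), add_zero, one_mul, hqwt]
      refine Matrix.exists_vecMul_eq_zero_iff.mp ⟨1, fun h => ?_, ?_⟩
      · have h' := congrFun h (B.equivFin ⟨c, hc⟩)
        exact one_ne_zero h'
      rw [vecMul_updateCol, MonskySelmerParity.one_vecMul_legendreMatrix q hqp hq2 hqinj,
        MonskySelmerParity.sum_addLegendreSym_neg_one_eq q hqp hq2, hprod, if_neg (by omega), h11,
        zero_smul]
      have hdot : (1 : Fin B.card → ZMod 2) ⬝ᵥ (fun x => addLegendreSym 2 (q x)) = 0 := by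
        rw [dotProduct]
        simp only [Pi.one_apply, one_mul]
        rw [sum_subtuple p B (fun n => addLegendreSym 2 n), hz, if_neg (by omega)]
      rw [hdot]
      exact Function.update_eq_self_iff.mpr rfl
    · -- `d ≡ 3, 5 (8)`: `(2/d) = -1`
      have h35 : (∏ i ∈ B, p i) % 8 = 3 ∨ (∏ i ∈ B, p i) % 8 = 5 := by omega
      rw [hz, if_pos h35, h11, zero_mul]

end Blocks

end Literature.NumberTheory.EllipticCurves.Smith2016
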